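import Literature.MathematicalPhysics.QuantumLattice.XYOrderDischarges
import Literature.MathematicalPhysics.QuantumLattice.LiebMattisLadder
import Literature.MathematicalPhysics.QuantumLattice.LiebMattisSectorPF
import Literature.MathematicalPhysics.QuantumLattice.SectorGroundProjContinuity

/-!
# Route `AnisotropyChord`: the one-magnon sector of the spin-½ XXZ model on a finite graph, I —
# configurations and matrix entries (toolkit for the no-go lemma against graph-general
# concavity / monotonicity in `Δ`; support `Concavity` = stmt-HubbardSuperconductivity-8150)

Notation of the route: `H(Δ) = xxzHamiltonian 1 G (−1) Δ = −Σ_{xy∈E}(SˣSˣ + SʸSʸ + Δ SᶻSᶻ)` on a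
finite simple graph `G` (the route takes `G = torusGraph 2 M`).

GRAPH-GENERAL bookkeeping for the magnetisation sector `S^z_tot = |V|/2 − 1` (ONE flipped spin,
"one magnon"; configurations `Pi.single i 1`, amplitudes `ψ(Pi.single i 1)`):

* `apply_eq_zero_of_mem_oneMagnonSector` / `mem_oneMagnonSector_of_support`: the sector is the
  coordinate subspace spanned by the one-magnon configurations (Tasaki eq. (2.4.5));
  `sum_eq_sum_single` re-indexes sums over it by sites; `testVec_apply_*`: real test vectors.
* `xxz_apply_single_single` / `xxz_apply_single_self`: the one-magnon block of `H(Δ)` is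
  `−½·A + Δ·(d_i/2 − |E|/4)·1` (`A` adjacency matrix, `d_i` degrees): off-diagonal `−½` per edge,
  diagonal `−Δ(|E|/4 − d_i/2)` (via `H(Δ) = −H_Heis(1) + (1−Δ)·ΣSᶻSᶻ` and the Lieb–Mattis
  matrix-element lemmas of the tree).

Part II (`…OneMagnonCoordinates`) turns this into energy / norm / condensate formulas. Elementary
finite-dimensional linear algebra; H. Tasaki, *Physics and Mathematics of Quantum Many-Body Systems*
(2020) §2.2, §2.4, App. A.3. No definition is introduced.
-/

set_option linter.dupNamespace false

noncomputable section

namespace Summit.HubbardSuperconductivity.HubbardSuperconductivity.Theorems.AnisotropyChord.OneMagnon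

open Matrix Complex Finset
open Literature.MathematicalPhysics.QuantumLattice

section Configs

variable {V : Type*} [Fintype V] [DecidableEq V]

/-- The one-magnon configuration `Pi.single i 1` has weight `1`. [folklore] -/
theorem weight_single (i : V) : (∑ z, ((Pi.single i (1 : Fin 2) : V → Fin 2) z : ℕ)) = 1 := by
  rw [Finset.sum_eq_single i]
  · simp
  · intro z _ hz; simp [hz]
  · intro h; exact absurd (Finset.mem_univ i) h

omit [Fintype V] in
/-- `i ↦ Pi.single i 1` is injective on sites. [folklore] -/
theorem single_inj {i j : V} (h : (Pi.single i (1 : Fin 2) : V → Fin 2) = Pi.single j 1) : i = j := by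
  by_contra hij
  have := congrFun h i
  rw [Pi.single_eq_same, Pi.single_eq_of_ne hij] at this
  exact absurd this (by decide)

omit [Fintype V] in
/-- Distinct sites give distinct one-magnon configurations. [folklore] -/
theorem single_ne_single {i j : V} (hij : i ≠ j) :
    (Pi.single i (1 : Fin 2) : V → Fin 2) ≠ Pi.single j 1 := fun h => hij (single_inj h)

/-- A configuration of weight `1` is a one-magnon configuration. [folklore] -/
theorem eq_single_of_weight_eq_one {σ : V → Fin 2} (h : (∑ z, (σ z : ℕ)) = 1) :
    ∃ i, σ = Pi.single i 1 := by
  have hex : ∃ i, σ i ≠ 0 := by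
    by_contra hno
    push Not at hno
    have h0 : (∑ z, (σ z : ℕ)) = 0 := Finset.sum_eq_zero fun z _ => by rw [hno z]; rfl
    omega
  obtain ⟨i, hi⟩ := hex
  have hi1 : (σ i : ℕ) = 1 := by
    have hle : (σ i : ℕ) ≤ ∑ z, (σ z : ℕ) :=
      Finset.single_le_sum (f := fun z => (σ z : ℕ)) (fun z _ => Nat.zero_le _) (Finset.mem_univ i)
    have hne : (σ i : ℕ) ≠ 0 := fun h0 => hi (Fin.ext h0)
    omega
  refine ⟨i, funext fun z => ?_⟩
  by_cases hz : z = i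
  · subst hz
    rw [Pi.single_eq_same]
    exact Fin.ext hi1
  · rw [Pi.single_eq_of_ne hz]
    have hle : (σ i : ℕ) + (σ z : ℕ) ≤ ∑ w, (σ w : ℕ) := by
      rw [← Finset.sum_pair (f := fun w => (σ w : ℕ)) (Ne.symm hz)]
      exact Finset.sum_le_sum_of_subset (Finset.subset_univ _)
    have h0 : (σ z : ℕ) = 0 := by omega
    exact Fin.ext h0

/-- **Re-indexing**: a function vanishing off the weight-`1` configurations sums over the sites.
[folklore] -/
theorem sum_eq_sum_single {β : Type*} [AddCommMonoid β] (f : (V → Fin 2) → β)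
    (hf : ∀ σ, (∑ z, (σ z : ℕ)) ≠ 1 → f σ = 0) :
    ∑ σ, f σ = ∑ i, f (Pi.single i 1) := by
  have hinj : ∀ i ∈ (Finset.univ : Finset V), ∀ j ∈ (Finset.univ : Finset V),
      (Pi.single i (1 : Fin 2) : V → Fin 2) = Pi.single j 1 → i = j := fun i _ j _ h => single_inj h
  rw [← Finset.sum_image hinj]
  symm
  refine Finset.sum_subset (Finset.subset_univ _) fun σ _ hσ => hf σ fun hw => ?_
  obtain ⟨i, rfl⟩ := eq_single_of_weight_eq_one hw
  exact hσ (Finset.mem_image_of_mem _ (Finset.mem_univ i))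

/-- Moving a configuration at one site changes the weight accordingly:
`W(σ[x ↦ l]) + σ_x = W(σ) + l`. [folklore] -/
theorem weight_update (σ : V → Fin 2) (x : V) (l : Fin 2) :
    (∑ z, ((Function.update σ x l) z : ℕ)) + (σ x : ℕ) = (∑ z, (σ z : ℕ)) + (l : ℕ) := by
  rw [← Finset.add_sum_erase _ _ (Finset.mem_univ x),
    ← Finset.add_sum_erase _ (fun z => (σ z : ℕ)) (Finset.mem_univ x), Function.update_self]
  have h : ∑ z ∈ Finset.univ.erase x, ((Function.update σ x l) z : ℕ) =
      ∑ z ∈ Finset.univ.erase x, (σ z : ℕ) :=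
    Finset.sum_congr rfl fun z hz => by rw [Function.update_of_ne (Finset.ne_of_mem_erase hz)]
  rw [h]
  ring

/-- **The one-magnon sector is a coordinate subspace**: a vector of the sector
`S^z_tot = |V|/2 − 1` vanishes off the weight-`1` configurations. Tasaki (2020) eq. (2.4.5).
[folklore] -/
theorem apply_eq_zero_of_mem_oneMagnonSector {ψ : (V → Fin 2) → ℂ}
    (hψ : ψ ∈ spinZSector (Λ := V) 1 ((Fintype.card V : ℝ) / 2 - 1))
    (σ : V → Fin 2) (hσ : (∑ z, (σ z : ℕ)) ≠ 1) : ψ σ = 0 := by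
  have h := LiebMattis.mem_spinZSector_weight_iff (Λ := V) 1 1 ψ
  have hlab : (((Fintype.card V * 1 : ℕ) : ℝ) / 2 - ((1 : ℕ) : ℝ)) = (Fintype.card V : ℝ) / 2 - 1 := by
    push_cast; ring
  rw [hlab] at h
  exact (h.mp hψ) σ hσ

/-- Conversely, a vector supported on the weight-`1` configurations lies in the one-magnon sector.
Tasaki (2020) eq. (2.4.5). [folklore] -/
theorem mem_oneMagnonSector_of_support {ψ : (V → Fin 2) → ℂ}
    (hψ : ∀ σ : V → Fin 2, (∑ z, (σ z : ℕ)) ≠ 1 → ψ σ = 0) :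
    ψ ∈ spinZSector (Λ := V) 1 ((Fintype.card V : ℝ) / 2 - 1) := by
  have h := LiebMattis.mem_spinZSector_weight_iff (Λ := V) 1 1 ψ
  have hlab : (((Fintype.card V * 1 : ℕ) : ℝ) / 2 - ((1 : ℕ) : ℝ)) = (Fintype.card V : ℝ) / 2 - 1 := by
    push_cast; ring
  rw [hlab] at h
  exact h.mpr hψ

/-- The REAL one-magnon test vector with amplitudes `y`: `φ_y = Σ_i y_i |i⟩`. Its value at a
one-magnon configuration. [folklore] -/
theorem testVec_apply_single (y : V → ℝ) (j : V) :
    (∑ i, ((y i : ℝ) : ℂ) • (Pi.single (Pi.single i (1 : Fin 2)) (1 : ℂ) :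
      (V → Fin 2) → ℂ)) (Pi.single j 1) = (y j : ℂ) := by
  rw [Finset.sum_apply, Finset.sum_eq_single j]
  · rw [Pi.smul_apply, Pi.single_eq_same, smul_eq_mul, mul_one]
  · intro i _ hij
    rw [Pi.smul_apply, Pi.single_eq_of_ne (single_ne_single (Ne.symm hij)), smul_zero]
  · intro h; exact absurd (Finset.mem_univ j) h

/-- The test vector vanishes off the weight-`1` configurations. [folklore] -/
theorem testVec_apply_of_weight_ne (y : V → ℝ) (σ : V → Fin 2) (hσ : (∑ z, (σ z : ℕ)) ≠ 1) :
    (∑ i, ((y i : ℝ) : ℂ) • (Pi.single (Pi.single i (1 : Fin 2)) (1 : ℂ) :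
      (V → Fin 2) → ℂ)) σ = 0 := by
  rw [Finset.sum_apply]
  refine Finset.sum_eq_zero fun i _ => ?_
  rw [Pi.smul_apply, Pi.single_eq_of_ne, smul_zero]
  rintro rfl
  exact hσ (weight_single i)

end Configs

section Hamiltonian

variable {V : Type*} [Fintype V] [DecidableEq V] (G : SimpleGraph V) [DecidableRel G.Adj]

/-- `H(Δ) = −H_Heis(J = 1) + (1 − Δ)·(Ising part)`, the Ising part being diagonal with entry
`(1 − Δ)·Z(σ)`, `Z(σ) = Σ_{xy∈E} (½ − σ_x)(½ − σ_y)` (the zero-field case of the BEC-route structure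
lemma `leadPF_ham_eq`, reproved here to keep this file route-independent). [folklore] -/
theorem xxz_eq_neg_heisenberg_add_diagonal (Δ : ℝ) :
    (xxzHamiltonian 1 G (-1) Δ : Op V 2) =
      -heisenbergHamiltonian 1 G 1 +
        diagonal fun σ => ((((1 - Δ) * ∑ e ∈ G.edgeFinset,
          Sym2.lift ⟨fun x y => ((1 : ℝ) / 2 - (σ x : ℕ)) * ((1 : ℝ) / 2 - (σ y : ℕ)),
            fun _ _ => mul_comm _ _⟩ e : ℝ)) : ℂ) := by
  -- `Sᶻ_x` and the `SᶻSᶻ` bonds are diagonal in the occupation basis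
  have hsite : ∀ x : V, (siteSpin 1 x 2 : Op V 2) = diagonal fun σ => (1 : ℂ) / 2 - ((σ x : ℕ) : ℂ) := by
    intro x
    rw [siteSpin, spinVec_two, SpinOperators.spinZ, LiebMattis.onSite_diagonal]
    simp only [Nat.cast_one]
  have hbond : ∀ x y : V, (spinBond 1 2 x y : Op V 2) =
      diagonal fun σ => ((1 : ℂ) / 2 - ((σ x : ℕ) : ℂ)) * ((1 : ℂ) / 2 - ((σ y : ℕ) : ℂ)) := by
    intro x y
    rw [spinBond, hsite, hsite, diagonal_mul_diagonal, diagonal_mul_diagonal, diagonal_add,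
      ← diagonal_smul]
    congr 1
    funext σ
    simp only [Pi.smul_apply, smul_eq_mul]
    ring
  -- the diagonal matrix as `(1 - Δ) • Σ_e SᶻSᶻ(e)`
  have hd : (diagonal fun σ : V → Fin 2 => ((((1 - Δ) * ∑ e ∈ G.edgeFinset,
      Sym2.lift ⟨fun x y => ((1 : ℝ) / 2 - (σ x : ℕ)) * ((1 : ℝ) / 2 - (σ y : ℕ)),
        fun _ _ => mul_comm _ _⟩ e : ℝ)) : ℂ)) =
      ((1 : ℂ) - Δ) • ∑ e ∈ G.edgeFinset,
        Sym2.lift ⟨fun x y => (spinBond 1 2 x y : Op V 2), fun x y => (spinBond_comm 1 2 x y).symm⟩ e := by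
    have hsum : (∑ e ∈ G.edgeFinset,
        Sym2.lift ⟨fun x y => (spinBond 1 2 x y : Op V 2), fun x y => (spinBond_comm 1 2 x y).symm⟩ e) =
        diagonal fun σ : V → Fin 2 => ((∑ e ∈ G.edgeFinset,
          Sym2.lift ⟨fun x y => ((1 : ℝ) / 2 - (σ x : ℕ)) * ((1 : ℝ) / 2 - (σ y : ℕ)),
            fun _ _ => mul_comm _ _⟩ e : ℝ) : ℂ) := by
      ext σ τ
      rw [Matrix.sum_apply, diagonal_apply]
      push_cast
      split_ifs with h
      · subst h
        refine Finset.sum_congr rfl fun e _ => ?_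
        induction e using Sym2.ind with
        | h x y =>
          simp only [Sym2.lift_mk]
          rw [hbond, diagonal_apply_eq]
          push_cast
          ring
      · refine Finset.sum_eq_zero fun e _ => ?_
        induction e using Sym2.ind with
        | h x y =>
          simp only [Sym2.lift_mk]
          rw [hbond, diagonal_apply_ne _ h]
    rw [hsum, smul_eq_diagonal_mul, diagonal_mul_diagonal]
    congr 1
    funext σ
    push_cast
    ring
  rw [hd, xxzHamiltonian, heisenbergHamiltonian]
  push_cast
  rw [neg_smul, one_smul, one_smul, ← Finset.sum_neg_distrib, Finset.smul_sum, ← Finset.sum_neg_distrib,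
    ← Finset.sum_add_distrib]
  refine Finset.sum_congr rfl fun e _ => ?_
  induction e using Sym2.ind with
  | h x y =>
    simp only [Sym2.lift_mk, spinDotSym_mk, spinDot, Fin.sum_univ_three]
    module

/-- Diagonal entries of `H_Heis(J = 1)`: `⟨σ|H_Heis|σ⟩ = Z(σ)`. [folklore] -/
theorem heisenberg_apply_self (σ : V → Fin 2) :
    heisenbergHamiltonian 1 G 1 σ σ =
      ((∑ e ∈ G.edgeFinset, Sym2.lift ⟨fun x y => ((1 : ℝ) / 2 - (σ x : ℕ)) * ((1 : ℝ) / 2 - (σ y : ℕ)),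
        fun _ _ => mul_comm _ _⟩ e : ℝ) : ℂ) := by
  rw [LiebMattis.heisenbergHamiltonian_apply]
  push_cast
  rw [one_mul]
  refine Finset.sum_congr rfl fun e he => ?_
  revert he
  induction e using Sym2.ind with
  | h x y =>
    intro he
    rw [SimpleGraph.mem_edgeFinset, SimpleGraph.mem_edgeSet] at he
    rw [spinDotSym_mk, LiebMattis.spinDot_apply_self 1 he.ne σ, Sym2.lift_mk]
    push_cast
    ring

/-- **Diagonal entries of `H(Δ)`**: `⟨σ|H(Δ)|σ⟩ = −Δ·Z(σ)`. [folklore] -/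
theorem xxz_apply_self (Δ : ℝ) (σ : V → Fin 2) :
    (xxzHamiltonian 1 G (-1) Δ : Op V 2) σ σ =
      -((Δ * ∑ e ∈ G.edgeFinset, Sym2.lift ⟨fun x y => ((1 : ℝ) / 2 - (σ x : ℕ)) * ((1 : ℝ) / 2 - (σ y : ℕ)),
        fun _ _ => mul_comm _ _⟩ e : ℝ) : ℂ) := by
  rw [xxz_eq_neg_heisenberg_add_diagonal, Matrix.add_apply, Matrix.neg_apply, diagonal_apply_eq,
    heisenberg_apply_self]
  push_cast
  ring

/-- The Ising weight of a one-magnon configuration: `Z(|i⟩) = |E|/4 − d_i/2` (edges through `i`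
contribute `−¼`, the others `+¼`). [folklore] -/
theorem isingWeight_single (i : V) :
    (∑ e ∈ G.edgeFinset, Sym2.lift ⟨fun x y =>
        ((1 : ℝ) / 2 - ((Pi.single i (1 : Fin 2) : V → Fin 2) x : ℕ)) *
          ((1 : ℝ) / 2 - ((Pi.single i (1 : Fin 2) : V → Fin 2) y : ℕ)), fun _ _ => mul_comm _ _⟩ e) =
      (G.edgeFinset.card : ℝ) / 4 - (G.degree i : ℝ) / 2 := by
  have hterm : ∀ e ∈ G.edgeFinset, Sym2.lift ⟨fun x y =>
        ((1 : ℝ) / 2 - ((Pi.single i (1 : Fin 2) : V → Fin 2) x : ℕ)) *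
          ((1 : ℝ) / 2 - ((Pi.single i (1 : Fin 2) : V → Fin 2) y : ℕ)), fun _ _ => mul_comm _ _⟩ e =
      if i ∈ e then -(1 / 4 : ℝ) else 1 / 4 := by
    intro e he
    revert he
    induction e using Sym2.ind with
    | h x y =>
      intro he
      rw [SimpleGraph.mem_edgeFinset, SimpleGraph.mem_edgeSet] at he
      have hxy : x ≠ y := he.ne
      simp only [Sym2.lift_mk]
      by_cases hx : i = x
      · subst hx
        rw [Pi.single_eq_same, Pi.single_eq_of_ne (Ne.symm hxy), if_pos (Sym2.mem_iff.mpr (Or.inl rfl))]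
        norm_num
      · by_cases hy : i = y
        · subst hy
          rw [Pi.single_eq_same, Pi.single_eq_of_ne (Ne.symm hx), if_pos (Sym2.mem_iff.mpr (Or.inr rfl))]
          norm_num
        · rw [Pi.single_eq_of_ne (Ne.symm hx), Pi.single_eq_of_ne (Ne.symm hy),
            if_neg (fun h => by rcases Sym2.mem_iff.mp h with h | h <;> [exact hx h; exact hy h])]
          norm_num
  rw [Finset.sum_congr rfl hterm, Finset.sum_ite, Finset.sum_const, Finset.sum_const,
    ← SimpleGraph.incidenceFinset_eq_filter, SimpleGraph.card_incidenceFinset_eq_degree]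
  have hcard := Finset.card_filter_add_card_filter_not (s := G.edgeFinset) (fun e => i ∈ e)
  rw [← SimpleGraph.incidenceFinset_eq_filter, SimpleGraph.card_incidenceFinset_eq_degree] at hcard
  have hc : ((Finset.filter (fun e => ¬ i ∈ e) G.edgeFinset).card : ℝ) =
      (G.edgeFinset.card : ℝ) - (G.degree i : ℝ) := by
    have := congrArg (fun n : ℕ => (n : ℝ)) hcard
    push_cast at this
    linarith
  rw [nsmul_eq_mul, nsmul_eq_mul, hc]
  ring

/-- **Diagonal one-magnon entries**: `⟨i|H(Δ)|i⟩ = −Δ(|E|/4 − d_i/2)`. Tasaki (2020) §2.4.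
[folklore] -/
theorem xxz_apply_single_self (Δ : ℝ) (i : V) :
    (xxzHamiltonian 1 G (-1) Δ : Op V 2) (Pi.single i 1) (Pi.single i 1) =
      -((Δ * ((G.edgeFinset.card : ℝ) / 4 - (G.degree i : ℝ) / 2) : ℝ) : ℂ) := by
  rw [xxz_apply_self, isingWeight_single]

/-- The exchange term between two distinct one-magnon configurations: only the edge `{i, j}`
(if present) connects `|i⟩` and `|j⟩`, with matrix element `½`. Tasaki (2020) §2.4. [folklore] -/
theorem spinDotSym_apply_single_single {i j : V} (hij : i ≠ j) {e : Sym2 V} (he : ¬ e.IsDiag) :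
    spinDotSym 1 e (Pi.single i (1 : Fin 2)) (Pi.single j 1) =
      if e = s(i, j) then (1 / 2 : ℂ) else 0 := by
  -- spin-½ ladder matrix elements `⟨0|S⁺|1⟩ = 1`, `⟨1|S⁺|0⟩ = 0`, `⟨1|S⁻|0⟩ = 1`, `⟨0|S⁻|1⟩ = 0`
  have hR01 : spinRaise 1 0 1 = 1 := by rw [spinRaise_apply]; norm_num
  have hR10 : spinRaise 1 1 0 = 0 := by rw [spinRaise_apply]; norm_num
  have hL10 : spinLower 1 1 0 = 1 := by rw [spinLower_apply]; norm_num
  have hL01 : spinLower 1 0 1 = 0 := by rw [spinLower_apply]; norm_num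
  revert he
  induction e using Sym2.ind with
  | h x y =>
    intro he
    have hxy : x ≠ y := fun h => he (Sym2.mk_isDiag_iff.mpr h)
    rw [spinDotSym_mk, LiebMattis.spinDot_apply_of_ne 1 hxy (single_ne_single hij)]
    by_cases hc : (x = i ∧ y = j) ∨ (x = j ∧ y = i)
    · rw [if_pos (Sym2.eq_iff.mpr hc)]
      rcases hc with ⟨rfl, rfl⟩ | ⟨rfl, rfl⟩
      · rw [if_pos (fun z hzx hzy => by rw [Pi.single_eq_of_ne hzx, Pi.single_eq_of_ne hzy]),
          Pi.single_eq_same, Pi.single_eq_of_ne hij, Pi.single_eq_of_ne hij.symm, Pi.single_eq_same,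
          hR10, hL10, hR01]
        norm_num
      · rw [if_pos (fun z hzx hzy => by rw [Pi.single_eq_of_ne hzy, Pi.single_eq_of_ne hzx]),
          Pi.single_eq_same, Pi.single_eq_of_ne hij, Pi.single_eq_of_ne hij.symm, Pi.single_eq_same,
          hR01, hL10, hR10, hL01]
        norm_num
    · rw [if_neg (fun h => hc (Sym2.eq_iff.mp h))]
      rw [if_neg]
      intro hC
      apply hc
      have hj : j = x ∨ j = y := by
        by_contra hn
        rw [not_or] at hn
        have := hC j hn.1 hn.2
        rw [Pi.single_eq_of_ne hij.symm, Pi.single_eq_same] at this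
        exact absurd this (by decide)
      have hi : i = x ∨ i = y := by
        by_contra hn
        rw [not_or] at hn
        have := hC i hn.1 hn.2
        rw [Pi.single_eq_same, Pi.single_eq_of_ne hij] at this
        exact absurd this (by decide)
      rcases hi with rfl | rfl
      · rcases hj with h | rfl
        · exact absurd h.symm hij
        · exact Or.inl ⟨rfl, rfl⟩
      · rcases hj with rfl | h
        · exact Or.inr ⟨rfl, rfl⟩
        · exact absurd h.symm hij

/-- **Off-diagonal one-magnon entries**: `⟨i|H(Δ)|j⟩ = −½` if `i ∼ j`, else `0` (`i ≠ j`).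
Tasaki (2020) §2.4. [folklore] -/
theorem xxz_apply_single_single (Δ : ℝ) {i j : V} (hij : i ≠ j) :
    (xxzHamiltonian 1 G (-1) Δ : Op V 2) (Pi.single i 1) (Pi.single j 1) =
      if G.Adj i j then -(1 / 2 : ℂ) else 0 := by
  rw [xxz_eq_neg_heisenberg_add_diagonal, Matrix.add_apply, Matrix.neg_apply,
    diagonal_apply_ne _ (single_ne_single hij), add_zero, LiebMattis.heisenbergHamiltonian_apply]
  push_cast
  rw [one_mul]
  have hsum : ∑ e ∈ G.edgeFinset, spinDotSym 1 e (Pi.single i (1 : Fin 2)) (Pi.single j 1) =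
      ∑ e ∈ G.edgeFinset, (if e = s(i, j) then (1 / 2 : ℂ) else 0) :=
    Finset.sum_congr rfl fun e he =>
      spinDotSym_apply_single_single hij
        (SimpleGraph.not_isDiag_of_mem_edgeSet _ (SimpleGraph.mem_edgeFinset.mp he))
  rw [hsum, Finset.sum_ite_eq']
  by_cases hadj : G.Adj i j
  · rw [if_pos (SimpleGraph.mem_edgeFinset.mpr hadj), if_pos hadj]
  · rw [if_neg (fun h => hadj (SimpleGraph.mem_edgeFinset.mp h)), if_neg hadj, neg_zero]

end Hamiltonian

end Summit.HubbardSuperconductivity.HubbardSuperconductivity.Theorems.AnisotropyChord.OneMagnon
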